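import Literature.Computability.MetaComplexity.NoRefuterSearch
import Literature.Computability.Complexity.CapBricks
import HarnessLib

/-!
# Hard `NP` languages without refuters (Chen–Jin–Santhanam–Williams, Thm. 1.9): the level recursion

Topic `Literature/Computability/MetaComplexity`. Third proof file of the corrected form of
[ChenEtAl2022, Thm. 1.9, first part], continuing `NoRefuterSearch.lean`: Claim 1 of the printed
proof ("If `L ∈ P` then `SAT ∈ P`", here: if the oracle language is in `P` then the certified tables
of `T` are computable level by level, so the tally-coded language `L'` is in `E`), as the memoised
recursion of [ChenEtAl2022, §6, Algorithm Solve] written with the tree's counted loops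
(`Brick.loopStep`, capped bodies `Brick.rcapF` of `CapBricks.lean`, `loopModel_rcapF_succ`):

* §G4 the middle loop `loopM` — the `2^{ℓ+1}` entries of level `ℓ+1` from the table of level `ℓ`
  (counter `c` from `2^{ℓ+1}` down, word `N = 2^{ℓ+1} + c - 1`, entries PREPENDED so that they come out
  in increasing order; `loopModel_bodyM_full`);
* §G5 the outer loop `loopO` — levels `1, …, m` (`loopModel_bodyO`);
* §G6 the algorithm on a padded input `lpad (2D) x` (`tabW_lpad`, `bitW_lpad_iff`), its running time
  `SearchLang_mem_E` (`preimage_mem_E`), and **`mem_E_of_oracle : L' ∈ E`**;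
* §G7 the choice of the format constant `D` (`exists_canon_fits`, `fitsLv_of_canon_fits`): every query
  of every level fits next to its table inside the canonical length.

No machine is programmed; no named fact is introduced (namespace `NoRefuter`).

## References

* L. Chen, C. Jin, R. Santhanam, R. Williams, *Constructive separations and their consequences*,
  FOCS 2021 / TheoretiCS 3 (2024), §6 (Proof of Thm. 1.9, Claim 1 and Algorithm Solve). [ChenEtAl2022]
* S. Arora, B. Barak, *Computational Complexity: A Modern Approach*, CUP 2009, §1.3, §1.4.1 (clocked
  loops). [AroraBarak2009]
-/

noncomputable section

namespace Literature.Computability.MetaComplexity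

open _root_.Computability Polynomial Complexity Brick Plumb Nondeterministic

namespace NoRefuter

section Middle

variable {V : Language Bool} {p : Polynomial ℕ} {D : ℕ} {O : Language Bool}

/-! #### G4. The middle loop: the `2^{ℓ+1}` entries of level `ℓ + 1`

Records `⟨xm, ⟨ctr, Acc⟩⟩`, `xm = ⟨r, ⟨lv, Tab⟩⟩`; the counter `c` runs from `2^{ℓ+1}` down to `1` and the round
with counter `c` PREPENDS the entry of `N = 2^{ℓ+1} + c - 1` to the accumulator, so that the entries end up
in increasing order. -/

/-- The middle record. [folklore] -/
def recM (r lv Tab c Acc : List Bool) : List Bool := boolPair (boolPair r (boolPair lv Tab)) (boolPair c Acc)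

/-- Accessors of the middle record: ruler, level, table, counter. [folklore] -/
def rM : List Bool → List Bool := nthF 0 ∘ fstF
/-- See `rM`. [folklore] -/
def lvM : List Bool → List Bool := nthF 1 ∘ fstF
/-- See `rM`. [folklore] -/
def tabM : List Bool → List Bool := sndPow 1 ∘ fstF
/-- See `rM`. [folklore] -/
def ctrM : List Bool → List Bool := nthF 1

/-- `1^{2^{ℓ+1}}` (against the ruler). [folklore] -/
def pow2lvM : List Bool → List Bool := binToUnaryFn ∘ fanoutFn rM (AvgNE.pow2NumF 1 ∘ fun z => lvM z ++ [true])

/-- The word `1ᴺ`, `N = 2^{ℓ+1} + c - 1`, of the current round. [folklore] -/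
def nNM : List Bool → List Bool := List.tail ∘ fun z => pow2lvM z ++ (binToUnaryFn ∘ fanoutFn rM ctrM) z

variable (p) in
/-- The initial record of the inner loop: context `⟨r, ⟨lv, ⟨Tab, 1ᴺ⟩⟩⟩`, counter `(p+1)(N)`, prefix `ε`.
[folklore] -/
def initIM : List Bool → List Bool :=
  fanoutFn (fanoutFn rM (fanoutFn lvM (fanoutFn tabM nNM))) (fanoutFn (lenBinF ∘ polyFn (p + 1) ∘ nNM) fun _ => [])

variable (p D O) in
/-- The witness found by the inner loop. [folklore] -/
def uStarM : List Bool → List Bool := sndPow 1 ∘ loopI p D O ∘ initIM p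

/-- The query "is `ε` extendable?", i.e. "`1ᴺ ∈ T`?". [folklore] -/
def qEpsM : List Bool → List Bool := fanoutFn nNM fun _ => []

variable (D O) in
/-- The test "`1ᴺ ∈ T`", asked to the oracle. [folklore] -/
def SM : Language Bool := embedF D tabM qEpsM ⁻¹' O

variable (p D O) in
/-- **The entry of the current round**: `⟨[1], u*⟩` if `1ᴺ ∈ T`, else `⟨[0], ε⟩`. [cite: ChenEtAl2022, §6 (Proof of Thm. 1.9, Claim 1)] -/
def entryM : List Bool → List Bool :=
  OracleCompose.condFn (SM D O) (pairFn (fun _ => [true]) (uStarM p D O)) fun _ => boolPair [false] []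

variable (p D O) in
/-- **The body of the middle loop**: prepend the entry to the accumulator. [folklore] -/
def bodyM : List Bool → List Bool := fanoutFn (entryM p D O) (sndPow 1)

/-- All the middle accessors are in `FP`. [folklore] -/
theorem nNM_mem_FP : rM ∈ FP ∧ lvM ∈ FP ∧ tabM ∈ FP ∧ ctrM ∈ FP ∧ pow2lvM ∈ FP ∧ nNM ∈ FP := by
  have hr : rM ∈ FP := comp_mem_FP (nthF_mem_FP 0) fstF_mem_FP
  have hl : lvM ∈ FP := comp_mem_FP (nthF_mem_FP 1) fstF_mem_FP
  have ht : tabM ∈ FP := comp_mem_FP (sndPow_mem_FP 1) fstF_mem_FP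
  have hc : ctrM ∈ FP := nthF_mem_FP 1
  have hp : pow2lvM ∈ FP := comp_mem_FP binToUnaryFn_mem_FP (fanoutFn_mem_FP hr
    (comp_mem_FP (AvgNE.pow2NumF_mem_FP 1) (append_mem_FP hl (const_mem_FP _))))
  exact ⟨hr, hl, ht, hc, hp, comp_mem_FP PRelSigma.tail_mem_FP
    (append_mem_FP hp (comp_mem_FP binToUnaryFn_mem_FP (fanoutFn_mem_FP hr hc)))⟩

/-- `initIM p ∈ FP`. [folklore] -/
theorem initIM_mem_FP : initIM p ∈ FP := by
  obtain ⟨hr, hl, ht, -, -, hn⟩ := nNM_mem_FP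
  exact fanoutFn_mem_FP (fanoutFn_mem_FP hr (fanoutFn_mem_FP hl (fanoutFn_mem_FP ht hn)))
    (fanoutFn_mem_FP (comp_mem_FP lenBinF_mem_FP (comp_mem_FP (polyFn_mem_FP _) hn)) (const_mem_FP _))

/-- `bodyM ∈ FP` when the oracle is in `P`. [cite: AroraBarak2009, §1.3] -/
theorem bodyM_mem_FP (hO : O ∈ Classes.P) : bodyM p D O ∈ FP := by
  obtain ⟨-, -, ht, -, -, hn⟩ := nNM_mem_FP
  have hu : uStarM p D O ∈ FP := comp_mem_FP (sndPow_mem_FP 1) (comp_mem_FP (loopI_mem_FP hO) initIM_mem_FP)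
  have hS : SM D O ∈ Classes.P := preimage_mem_P hO (embedF_mem_FP ht (fanoutFn_mem_FP hn (const_mem_FP _)))
  exact fanoutFn_mem_FP (OracleCompose.condFn_mem_FP hS (pairFn_mem_FP (const_mem_FP _) hu) (const_mem_FP _))
    (sndPow_mem_FP 1)

/-! Values on a well-formed middle record `recM r (1^ℓ) Tab (encodeNat c) Acc`, `1 ≤ c ≤ 2^{ℓ+1}`,
`|r| ≥ canon D ℓ`. -/

section Values

variable {r Tab Acc : List Bool} {ℓ c : ℕ}

/-- The context accessors on a middle record. [folklore] -/
@[simp] theorem accM_recM (r lv Tab cc Acc : List Bool) :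
    rM (recM r lv Tab cc Acc) = r ∧ lvM (recM r lv Tab cc Acc) = lv ∧ tabM (recM r lv Tab cc Acc) = Tab ∧
      ctrM (recM r lv Tab cc Acc) = cc := by
  simp [rM, lvM, tabM, ctrM, recM, nthF, sndPow]

/-- `2^{ℓ+1} ≤ |r|` for a ruler of level `ℓ`. [folklore] -/
theorem two_pow_succ_le_ruler (hD : 0 < D) (hr : canon D ℓ ≤ r.length) : 2 ^ (ℓ + 1) ≤ r.length :=
  (two_pow_succ_le_canon hD ℓ).trans hr

/-- `pow2lvM` reads `1^{2^{ℓ+1}}`. [folklore] -/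
theorem pow2lvM_recM (hD : 0 < D) (hr : canon D ℓ ≤ r.length) (cc : List Bool) :
    pow2lvM (recM r (ones ℓ) Tab cc Acc) = ones (2 ^ (ℓ + 1)) := by
  simp only [pow2lvM, Function.comp_apply, fanoutFn_apply, (accM_recM r (ones ℓ) Tab cc Acc).1,
    (accM_recM r (ones ℓ) Tab cc Acc).2.1, binToUnaryFn_boolPair, AvgNE.bitsToNat_pow2NumF, List.length_append,
    List.length_replicate, List.length_singleton, one_mul, min_eq_left (two_pow_succ_le_ruler hD hr)]

/-- `nNM` reads `1ᴺ`, `N = 2^{ℓ+1} + c - 1`. [folklore] -/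
theorem nNM_recM (hD : 0 < D) (hr : canon D ℓ ≤ r.length) (hc : c ≤ 2 ^ (ℓ + 1)) :
    nNM (recM r (ones ℓ) Tab (encodeNat c) Acc) = ones (2 ^ (ℓ + 1) + c - 1) := by
  have hcr : c ≤ r.length := hc.trans (two_pow_succ_le_ruler hD hr)
  simp only [nNM, Function.comp_apply, pow2lvM_recM hD hr, fanoutFn_apply, (accM_recM r (ones ℓ) Tab _ Acc).1,
    (accM_recM r (ones ℓ) Tab _ Acc).2.2.2, binToUnaryFn_boolPair, bitsToNat_encodeNat, min_eq_left hcr,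
    Com.ones_append]
  simp [ones, List.tail_replicate]

/-- `initIM` builds the initial inner record `recI r 1^ℓ Tab 1ᴺ (encodeNat (p N + 1)) ε`. [folklore] -/
theorem initIM_recM (hD : 0 < D) (hr : canon D ℓ ≤ r.length) (hc : c ≤ 2 ^ (ℓ + 1)) :
    initIM p (recM r (ones ℓ) Tab (encodeNat c) Acc) =
      recI r (ones ℓ) Tab (ones (2 ^ (ℓ + 1) + c - 1)) (encodeNat (p.eval (2 ^ (ℓ + 1) + c - 1) + 1)) [] := by
  simp only [initIM, fanoutFn_apply, Function.comp_apply, nNM_recM hD hr hc, (accM_recM r (ones ℓ) Tab _ Acc).1,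
    (accM_recM r (ones ℓ) Tab _ Acc).2.1, (accM_recM r (ones ℓ) Tab _ Acc).2.2.1, lenBinF_apply, polyFn_apply,
    List.length_replicate, eval_add, eval_one, recI]

/-- `qEpsM` builds the query `⟨1ᴺ, ε⟩`. [folklore] -/
theorem qEpsM_recM (hD : 0 < D) (hr : canon D ℓ ≤ r.length) (hc : c ≤ 2 ^ (ℓ + 1)) :
    qEpsM (recM r (ones ℓ) Tab (encodeNat c) Acc) = boolPair (ones (2 ^ (ℓ + 1) + c - 1)) [] := by
  simp only [qEpsM, fanoutFn_apply, nNM_recM hD hr hc]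

end Values


/-! Semantics of the middle loop. -/

variable (p D) in
/-- The size hypothesis of level `ℓ`: every query of the level fits next to the table `Tab`. [folklore] -/
def FitsLv (ℓ : ℕ) (Tab : List Bool) : Prop :=
  ∀ q : List Bool, q.length ≤ 2 * 2 ^ (ℓ + 2) + p.eval (2 ^ (ℓ + 2)) + 4 → Fits D ℓ Tab q

variable {r Acc : List Bool} {ℓ c : ℕ} {es : List (List Bool)}

/-- Bounds on the word of the round: `2^{ℓ+1} ≤ N < 2^{ℓ+2}`. [folklore] -/
theorem N_bounds (hc1 : 1 ≤ c) (hc : c ≤ 2 ^ (ℓ + 1)) :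
    2 ^ (ℓ + 1) ≤ 2 ^ (ℓ + 1) + c - 1 ∧ 2 ^ (ℓ + 1) + c - 1 < 2 ^ (ℓ + 2) ∧
      2 ^ (ℓ + 1) + c - 1 = 2 ^ (ℓ + 1) + (c - 1) := by
  rw [pow_succ 2 (ℓ + 1)]; omega

/-- **The witness of the round**: `uStarM` is the result of `p N + 1` steps of the prefix search from `ε`.
[cite: ChenEtAl2022, §6 (Proof of Thm. 1.9, Claim 1)] -/
theorem uStarM_recM (hD : 0 < D) (hO : OracleOK V p D O) (hes : TableOK V p ℓ es) (hr : canon D ℓ ≤ r.length)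
    (hfit : FitsLv p D ℓ (OracleCompose.body es)) (hc1 : 1 ≤ c) (hc : c ≤ 2 ^ (ℓ + 1)) :
    uStarM p D O (recM r (ones ℓ) (OracleCompose.body es) (encodeNat c) Acc) =
      (stepFn V p (2 ^ (ℓ + 1) + c - 1))^[p.eval (2 ^ (ℓ + 1) + c - 1) + 1] [] := by
  obtain ⟨hN1, hN2, -⟩ := N_bounds hc1 hc
  set N := 2 ^ (ℓ + 1) + c - 1 with hN
  rw [uStarM, Function.comp_apply, Function.comp_apply, initIM_recM hD hr hc, loopI, recI, fstF_boolPair]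
  have hK : p.eval N + 1 ≤ (p + 1).eval (boolPair r (boolPair (ones ℓ) (boolPair (OracleCompose.body es) (ones N)))).length := by
    rw [eval_add, eval_one]
    refine Nat.add_le_add_right (TM2Iter.eval_mono p ?_) 1
    simp only [length_boolPair, List.length_replicate]; omega
  rw [iterate_loopStep _ _ _ _ _ hK, sndPow_succ_boolPair, sndPow_zero_boolPair]
  refine loopModel_bodyI hO hes hr (K₀ := p.eval N + 1) (fun q hq => hfit q (hq.trans ?_)) _ [] (by simp)
  have := TM2Iter.eval_mono p hN2.le
  omega

/-- **The oracle answers "`1ᴺ ∈ T`?"** on the middle record. [cite: ChenEtAl2022, §6 (Proof of Thm. 1.9, Claim 1)] -/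
theorem mem_SM_iff (hD : 0 < D) (hO : OracleOK V p D O) (hes : TableOK V p ℓ es) (hr : canon D ℓ ≤ r.length)
    (hfit : FitsLv p D ℓ (OracleCompose.body es)) (hc1 : 1 ≤ c) (hc : c ≤ 2 ^ (ℓ + 1)) :
    recM r (ones ℓ) (OracleCompose.body es) (encodeNat c) Acc ∈ SM D O ↔ Ext V p (2 ^ (ℓ + 1) + c - 1) [] := by
  obtain ⟨hN1, hN2, -⟩ := N_bounds hc1 hc
  rw [SM, memL_preimage]
  have hc' : canonLvF D (recM r (ones ℓ) (OracleCompose.body es) (encodeNat c) Acc) = ones (canon D ℓ) :=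
    canonLvF_apply hr
  have hq := qEpsM_recM (Tab := OracleCompose.body es) (Acc := Acc) hD hr hc
  have ht := (accM_recM r (ones ℓ) (OracleCompose.body es) (encodeNat c) Acc).2.2.1
  have hfit' : 2 * (tabM (recM r (ones ℓ) (OracleCompose.body es) (encodeNat c) Acc)).length +
      2 * (qEpsM (recM r (ones ℓ) (OracleCompose.body es) (encodeNat c) Acc)).length + 4 ≤ canon D ℓ := by
    rw [ht, hq]
    exact hfit _ (by simp only [length_boolPair, List.length_replicate, List.length_nil]; omega)
  have hval := embedF_apply (tabF := tabM) (qF := qEpsM) hc'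
  have hlen := length_embedF (tabF := tabM) (qF := qEpsM) hc' hfit'
  rw [hval] at hlen ⊢
  rw [ht, hq] at hlen ⊢
  rw [hO ℓ es _ _ hes hlen]
  change (∃ v, ValidW V p (fstF (boolPair (ones (2 ^ (ℓ + 1) + c - 1)) [])).length
    (sndF (boolPair (ones (2 ^ (ℓ + 1) + c - 1)) []) ++ v)) ↔ _
  simp only [fstF_boolPair, sndF_boolPair, List.length_replicate, Ext]

/-- **The body of the middle loop prepends the entry of `1ᴺ`.** [cite: ChenEtAl2022, §6 (Proof of Thm. 1.9, Claim 1)] -/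
theorem bodyM_recM (hD : 0 < D) (hO : OracleOK V p D O) (hes : TableOK V p ℓ es) (hr : canon D ℓ ≤ r.length)
    (hfit : FitsLv p D ℓ (OracleCompose.body es)) (hc1 : 1 ≤ c) (hc : c ≤ 2 ^ (ℓ + 1)) :
    bodyM p D O (recM r (ones ℓ) (OracleCompose.body es) (encodeNat c) Acc) =
      boolPair (entryOf V p (2 ^ (ℓ + 1) + c - 1)) Acc := by
  have hu := uStarM_recM (Acc := Acc) hD hO hes hr hfit hc1 hc
  have hS := mem_SM_iff (Acc := Acc) hD hO hes hr hfit hc1 hc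
  have hacc : sndPow 1 (recM r (ones ℓ) (OracleCompose.body es) (encodeNat c) Acc) = Acc := by
    simp [recM, sndPow]
  rw [bodyM, fanoutFn_apply, hacc, entryM, OracleCompose.condFn_apply, entryOf]
  by_cases he : Ext V p (2 ^ (ℓ + 1) + c - 1) []
  · rw [if_pos (hS.2 he), if_pos he, pairFn_apply, hu]
  · rw [if_neg (fun h => he (hS.1 h)), if_neg he]

variable (p) in
/-- The growth polynomial of the middle loop: `2 (p(2n) + 4) + 2`. [folklore] -/
def Gm : Polynomial ℕ := 2 * (p.comp (2 * X) + 4) + 2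

/-- **The growth bound of the middle body on a well-formed record.** [folklore] -/
theorem length_bodyM_recM (hD : 0 < D) (hO : OracleOK V p D O) (hes : TableOK V p ℓ es) (hr : canon D ℓ ≤ r.length)
    (hfit : FitsLv p D ℓ (OracleCompose.body es)) (hc1 : 1 ≤ c) (hc : c ≤ 2 ^ (ℓ + 1)) :
    (bodyM p D O (recM r (ones ℓ) (OracleCompose.body es) (encodeNat c) Acc)).length ≤
      Acc.length + (Gm p).eval (boolPair r (boolPair (ones ℓ) (OracleCompose.body es))).length := by
  obtain ⟨hN1, hN2, -⟩ := N_bounds hc1 hc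
  rw [bodyM_recM hD hO hes hr hfit hc1 hc, length_boolPair]
  have he := length_entryOf_le (V := V) (p := p) (2 ^ (ℓ + 1) + c - 1)
  have h2 : 2 ^ (ℓ + 1) ≤ r.length := two_pow_succ_le_ruler hD hr
  have hmono : p.eval (2 ^ (ℓ + 1) + c - 1) ≤
      p.eval (2 * (boolPair r (boolPair (ones ℓ) (OracleCompose.body es))).length) :=
    TM2Iter.eval_mono p (by simp only [length_boolPair]; rw [pow_succ] at hN2; omega)
  simp only [Gm, eval_add, eval_mul, eval_ofNat, eval_comp, eval_X]
  omega

/-- The code of a list laid onto an accumulator: `codeOnto [e₀, …] Acc = ⟨e₀, ⟨…, Acc⟩⟩`. [folklore] -/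
def codeOnto (es : List (List Bool)) (Acc : List Bool) : List Bool := es.foldr boolPair Acc

/-- `body es = codeOnto es ε`. [folklore] -/
theorem body_eq_codeOnto (es : List (List Bool)) : OracleCompose.body es = codeOnto es [] := rfl

/-- Laying a snoc-list: first the last entry. [folklore] -/
theorem codeOnto_append_singleton (es : List (List Bool)) (e Acc : List Bool) :
    codeOnto (es ++ [e]) Acc = codeOnto es (boolPair e Acc) := by
  simp [codeOnto, List.foldr_append]

/-- **Semantics of the middle loop**: `c ≤ 2^{ℓ+1}` rounds from the accumulator `Acc` lay the entries of
`1^{2^{ℓ+1} + j}`, `j < c`, onto `Acc` (in increasing order). [cite: ChenEtAl2022, §6 (Proof of Thm. 1.9, Claim 1)] -/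
theorem loopModel_bodyM (hD : 0 < D) (hO : OracleOK V p D O) (hes : TableOK V p ℓ es) (hr : canon D ℓ ≤ r.length)
    (hfit : FitsLv p D ℓ (OracleCompose.body es)) :
    ∀ (c : ℕ) (Acc : List Bool), c ≤ 2 ^ (ℓ + 1) →
      loopModel (rcapF (Gm p) (bodyM p D O)) (boolPair r (boolPair (ones ℓ) (OracleCompose.body es))) c Acc =
        codeOnto ((List.range c).map fun j => entryOf V p (2 ^ (ℓ + 1) + j)) Acc
  | 0, Acc, _ => rfl
  | c + 1, Acc, hc => by
    have hb := bodyM_recM (Acc := Acc) hD hO hes hr hfit (Nat.succ_pos c) hc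
    have hl := length_bodyM_recM (Acc := Acc) hD hO hes hr hfit (Nat.succ_pos c) hc
    rw [recM] at hb hl
    rw [loopModel_rcapF_succ c Acc hl, hb, loopModel_bodyM hD hO hes hr hfit c _ (by omega), List.range_succ,
      List.map_append, List.map_singleton, codeOnto_append_singleton]
    congr 2

/-- **The middle loop computes the next table**: `2^{ℓ+1}` rounds from `ε` give `body (esOf (ℓ+1))`.
[cite: ChenEtAl2022, §6 (Proof of Thm. 1.9, Claim 1)] -/
theorem loopModel_bodyM_full (hD : 0 < D) (hO : OracleOK V p D O) (hes : TableOK V p ℓ es) (hr : canon D ℓ ≤ r.length)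
    (hfit : FitsLv p D ℓ (OracleCompose.body es)) :
    loopModel (rcapF (Gm p) (bodyM p D O)) (boolPair r (boolPair (ones ℓ) (OracleCompose.body es))) (2 ^ (ℓ + 1)) [] =
      OracleCompose.body (esOf V p (ℓ + 1)) := by
  rw [loopModel_bodyM hD hO hes hr hfit _ _ le_rfl, body_eq_codeOnto, esOf]

end Middle

section Outer

variable {V : Language Bool} {p : Polynomial ℕ} {D : ℕ} {O : Language Bool}

/-! #### G5. The outer loop: levels `1, …, m`

Records `⟨xo, ⟨ctr, Tab⟩⟩`, `xo = ⟨r, 1ᵐ⟩`; the round with counter `c` (from `m` down to `1`) holds the table of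
level `ℓ = m - c` and replaces it by the table of level `ℓ + 1`, computed by the middle loop. -/

variable (p D O) in
/-- **The middle loop** `z ↦ (loopStep (rcapF Gm bodyM))^{|fstF z|} z` (capped body, `CapBricks.lean`). [folklore] -/
def loopM : List Bool → List Bool := fun z => (loopStep (rcapF (Gm p) (bodyM p D O)))^[(X : Polynomial ℕ).eval (fstF z).length] z

/-- `loopM ∈ FP` when the oracle is in `P` (`Brick.loopFn_rcapF_mem_FP`). [cite: AroraBarak2009, §1.3 (bounded loops)] -/
theorem loopM_mem_FP (hO : O ∈ Classes.P) : loopM p D O ∈ FP := loopFn_rcapF_mem_FP (bodyM_mem_FP hO) (Gm p) X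

/-- The outer record. [folklore] -/
def recO (r mm c Tab : List Bool) : List Bool := boolPair (boolPair r mm) (boolPair c Tab)

/-- Accessors of the outer record: ruler, `1ᵐ`, counter, table. [folklore] -/
def rO : List Bool → List Bool := fstF ∘ fstF
/-- See `rO`. [folklore] -/
def mmO : List Bool → List Bool := sndF ∘ fstF
/-- See `rO`. [folklore] -/
def ctrO : List Bool → List Bool := nthF 1
/-- See `rO`. [folklore] -/
def tabO : List Bool → List Bool := sndPow 1

/-- The level `1^{m - c}` of the table held by the outer record. [folklore] -/
def lvO : List Bool → List Bool := dropFn ∘ fanoutFn (binToUnaryFn ∘ fanoutFn rO ctrO) mmO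

/-- The initial record of the middle loop: context `⟨r, ⟨1^ℓ, Tab⟩⟩`, counter `2^{ℓ+1}`, accumulator `ε`.
[folklore] -/
def initMO : List Bool → List Bool :=
  fanoutFn (fanoutFn rO (fanoutFn lvO tabO)) (fanoutFn (AvgNE.pow2NumF 1 ∘ fun z => lvO z ++ [true]) fun _ => [])

variable (p D O) in
/-- **The body of the outer loop**: the next table. [cite: ChenEtAl2022, §6 (Proof of Thm. 1.9, Claim 1: memoised recursion on m)] -/
def bodyO : List Bool → List Bool := sndPow 1 ∘ loopM p D O ∘ initMO

/-- `initMO ∈ FP`. [folklore] -/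
theorem initMO_mem_FP : initMO ∈ FP := by
  have hr : rO ∈ FP := comp_mem_FP fstF_mem_FP fstF_mem_FP
  have hl : lvO ∈ FP := comp_mem_FP dropFn_mem_FP (fanoutFn_mem_FP
    (comp_mem_FP binToUnaryFn_mem_FP (fanoutFn_mem_FP hr (nthF_mem_FP 1))) (comp_mem_FP sndF_mem_FP fstF_mem_FP))
  exact fanoutFn_mem_FP (fanoutFn_mem_FP hr (fanoutFn_mem_FP hl (sndPow_mem_FP 1)))
    (fanoutFn_mem_FP (comp_mem_FP (AvgNE.pow2NumF_mem_FP 1) (append_mem_FP hl (const_mem_FP _))) (const_mem_FP _))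

/-- `bodyO ∈ FP` when the oracle is in `P`. [cite: AroraBarak2009, §1.3] -/
theorem bodyO_mem_FP (hO : O ∈ Classes.P) : bodyO p D O ∈ FP :=
  comp_mem_FP (sndPow_mem_FP 1) (comp_mem_FP (loopM_mem_FP hO) initMO_mem_FP)

variable {r Tab : List Bool} {m c : ℕ}

/-- `lvO` reads the level `1^{m-c}`. [folklore] -/
theorem lvO_recO (hD : 0 < D) (hr : canon D m ≤ r.length) (hc : c ≤ m) :
    lvO (recO r (ones m) (encodeNat c) Tab) = ones (m - c) := by
  have hcr : c ≤ r.length := hc.trans ((le_canon hD m).trans hr)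
  simp only [lvO, rO, ctrO, mmO, recO, Function.comp_apply, fanoutFn_apply, fstF_boolPair, sndF_boolPair, nthF,
    binToUnaryFn_boolPair, bitsToNat_encodeNat, min_eq_left hcr, dropFn_boolPair, List.length_replicate, Com.drop_ones]

/-- `initMO` builds the initial middle record of level `ℓ = m - c`. [folklore] -/
theorem initMO_recO (hD : 0 < D) (hr : canon D m ≤ r.length) (hc : c ≤ m) :
    initMO (recO r (ones m) (encodeNat c) Tab) =
      boolPair (boolPair r (boolPair (ones (m - c)) Tab)) (boolPair (encodeNat (2 ^ (m - c + 1))) []) := by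
  have hl := lvO_recO (Tab := Tab) hD hr hc
  have hp : AvgNE.pow2NumF 1 (ones (m - c) ++ [true]) = encodeNat (2 ^ (m - c + 1)) := by
    rw [← encodeNat_two_pow_mul_length]; simp
  simp only [initMO, fanoutFn_apply, Function.comp_apply, hl, hp]
  simp [rO, tabO, recO, sndPow]

/-- **The outer body computes the next table.** [cite: ChenEtAl2022, §6 (Proof of Thm. 1.9, Claim 1)] -/
theorem bodyO_recO (hD : 0 < D) (hO : OracleOK V p D O) (hr : canon D m ≤ r.length) (hc : c ≤ m)
    (hfit : FitsLv p D (m - c) (OracleCompose.body (esOf V p (m - c)))) :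
    bodyO p D O (recO r (ones m) (encodeNat c) (OracleCompose.body (esOf V p (m - c)))) =
      OracleCompose.body (esOf V p (m - c + 1)) := by
  have hrl : canon D (m - c) ≤ r.length := ((canon_strictMono hD).monotone (Nat.sub_le m c)).trans hr
  rw [bodyO, Function.comp_apply, Function.comp_apply, initMO_recO hD hr hc, loopM, fstF_boolPair]
  have hK : 2 ^ (m - c + 1) ≤ (X : Polynomial ℕ).eval
      (boolPair r (boolPair (ones (m - c)) (OracleCompose.body (esOf V p (m - c))))).length := by
    have := two_pow_succ_le_ruler hD hrl
    simp only [eval_X, length_boolPair]; omega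
  rw [iterate_loopStep _ _ _ _ _ hK, sndPow_succ_boolPair, sndPow_zero_boolPair]
  exact loopModel_bodyM_full hD hO (tableOK_esOf (m - c)) hrl hfit

variable (p) in
/-- The growth polynomial of the outer loop: `n (2 p(n) + 10)`. [folklore] -/
def Go : Polynomial ℕ := X * (2 * p + 10)

/-- **The growth bound of the outer body on a well-formed record.** [folklore] -/
theorem length_bodyO_recO (hD : 0 < D) (hO : OracleOK V p D O) (hr : canon D m ≤ r.length) (hc1 : 1 ≤ c) (hc : c ≤ m)
    (hfit : FitsLv p D (m - c) (OracleCompose.body (esOf V p (m - c)))) :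
    (bodyO p D O (recO r (ones m) (encodeNat c) (OracleCompose.body (esOf V p (m - c))))).length ≤
      (OracleCompose.body (esOf V p (m - c))).length + (Go p).eval (boolPair r (ones m)).length := by
  rw [bodyO_recO hD hO hr hc hfit]
  refine (length_body_esOf_le (m - c + 1)).trans (le_add_left ?_)
  have h1 : 2 ^ (m + 1) ≤ r.length := two_pow_succ_le_ruler hD hr
  have h2 : 2 ^ (m - c + 1) ≤ (boolPair r (ones m)).length := by
    have := Nat.pow_le_pow_right two_pos (show m - c + 1 ≤ m + 1 by omega)
    simp only [length_boolPair]; omega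
  have h3 : 2 ^ (m - c + 1 + 1) ≤ (boolPair r (ones m)).length := by
    have := Nat.pow_le_pow_right two_pos (show m - c + 1 + 1 ≤ m + 1 by omega)
    simp only [length_boolPair]; omega
  have hmono := TM2Iter.eval_mono p h3
  simp only [Go, eval_mul, eval_X, eval_add, eval_ofNat]
  exact Nat.mul_le_mul h2 (by omega)

/-- **Semantics of the outer loop**: `c ≤ m` rounds from the table of level `m - c` give the table of
level `m`. [cite: ChenEtAl2022, §6 (Proof of Thm. 1.9, Claim 1)] -/
theorem loopModel_bodyO (hD : 0 < D) (hO : OracleOK V p D O) (hr : canon D m ≤ r.length)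
    (hfit : ∀ ℓ, FitsLv p D ℓ (OracleCompose.body (esOf V p ℓ))) :
    ∀ c : ℕ, c ≤ m → loopModel (rcapF (Go p) (bodyO p D O)) (boolPair r (ones m)) c
      (OracleCompose.body (esOf V p (m - c))) = OracleCompose.body (esOf V p m)
  | 0, _ => rfl
  | c + 1, hc => by
    have hb := bodyO_recO hD hO hr hc (hfit _)
    have hl := length_bodyO_recO hD hO hr (Nat.succ_pos c) hc (hfit _)
    rw [recO] at hb hl
    rw [loopModel_rcapF_succ c _ hl, hb, show m - (c + 1) + 1 = m - c by omega]
    exact loopModel_bodyO hD hO hr hfit c (by omega)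

/-! #### G6. The whole algorithm on a padded input, and `L' ∈ E` -/

variable (p D O) in
/-- **The outer loop** `z ↦ (loopStep (rcapF Go bodyO))^{|fstF z|} z`. [folklore] -/
def loopO : List Bool → List Bool := fun z => (loopStep (rcapF (Go p) (bodyO p D O)))^[(X : Polynomial ℕ).eval (fstF z).length] z

/-- `loopO ∈ FP` when the oracle is in `P`. [cite: AroraBarak2009, §1.3 (bounded loops)] -/
theorem loopO_mem_FP (hO : O ∈ Classes.P) : loopO p D O ∈ FP := loopFn_rcapF_mem_FP (bodyO_mem_FP hO) (Go p) X

variable (V p D) in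
/-- The initial record of the outer loop on a padded input `w`: context `⟨ruler, 1^{|snd w|}⟩`, counter `|snd w|`,
table of level `0` (a constant). [folklore] -/
def initOW : List Bool → List Bool :=
  fanoutFn (fanoutFn (rulerFn D) (onesFn ∘ sndF))
    (fanoutFn (lenBinF ∘ onesFn ∘ sndF) fun _ => OracleCompose.body (esOf V p 0))

variable (V p D O) in
/-- **The table of the payload's level**, computed on the padded input. [cite: ChenEtAl2022, §6 (Proof of Thm. 1.9, Claim 1)] -/
def tabW : List Bool → List Bool := sndPow 1 ∘ loopO p D O ∘ initOW V p D

variable (V p D O) in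
/-- **The bit of the payload** read from the computed table. [folklore] -/
def bitW : List Bool → List Bool := fstF ∘ HashBricks.nthItemFn ∘ fanoutFn (idxOnesFn D) (tabW V p D O)

/-- `bitW ∈ FP` when the oracle is in `P`. [cite: AroraBarak2009, §1.3] -/
theorem bitW_mem_FP (hO : O ∈ Classes.P) : bitW V p D O ∈ FP := by
  have hi : initOW V p D ∈ FP := fanoutFn_mem_FP (fanoutFn_mem_FP (rulerFn_mem_FP D) (comp_mem_FP onesFn_mem_FP sndF_mem_FP))
    (fanoutFn_mem_FP (comp_mem_FP lenBinF_mem_FP (comp_mem_FP onesFn_mem_FP sndF_mem_FP)) (const_mem_FP _))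
  have ht : tabW V p D O ∈ FP := comp_mem_FP (sndPow_mem_FP 1) (comp_mem_FP (loopO_mem_FP hO) hi)
  exact comp_mem_FP fstF_mem_FP (comp_mem_FP HashBricks.nthItemFn_mem_FP (fanoutFn_mem_FP (idxOnesFn_mem_FP D) ht))

/-- `onesFn x = 1^{|x|}`. [folklore] -/
theorem onesFn_eq_ones (x : List Bool) : onesFn x = ones x.length := by
  simp [onesFn, unaryEncodeNat_eq_replicate]

/-- **The computed table is the model table** `body (esOf |x|)`. [cite: ChenEtAl2022, §6 (Proof of Thm. 1.9, Claim 1)] -/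
theorem tabW_lpad (hD : 0 < D) (hO : OracleOK V p D O) (hfit : ∀ ℓ, FitsLv p D ℓ (OracleCompose.body (esOf V p ℓ)))
    (x : List Bool) : tabW V p D O (lpad (2 * D) x) = OracleCompose.body (esOf V p x.length) := by
  have hr : canon D x.length ≤ (rulerFn D (lpad (2 * D) x)).length := by
    rw [rulerFn_apply, List.length_replicate]; exact canon_le_ruler x
  have hinit : initOW V p D (lpad (2 * D) x) = boolPair (boolPair (rulerFn D (lpad (2 * D) x)) (ones x.length))
      (boolPair (encodeNat x.length) (OracleCompose.body (esOf V p 0))) := by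
    simp only [initOW, fanoutFn_apply, Function.comp_apply, sndF_lpad, onesFn_eq_ones, lenBinF_apply,
      List.length_replicate]
  rw [tabW, Function.comp_apply, Function.comp_apply, hinit, loopO, fstF_boolPair]
  have hK : x.length ≤ (X : Polynomial ℕ).eval (boolPair (rulerFn D (lpad (2 * D) x)) (ones x.length)).length := by
    simp only [eval_X, length_boolPair, List.length_replicate]; omega
  rw [iterate_loopStep _ _ _ _ _ hK, sndPow_succ_boolPair, sndPow_zero_boolPair]
  have h := loopModel_bodyO hD hO hr hfit x.length le_rfl
  rwa [Nat.sub_self] at h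

/-- **The computed bit is the truth**: `bitW (lpad (2D) x) = [1] ↔ 1^{2^{|x|} + ⟦x⟧} ∈ T`. [cite: ChenEtAl2022, §6 (Proof of Thm. 1.9, Claim 1)] -/
theorem bitW_lpad_iff {T : Language Bool} (hD : 0 < D) (hver : IsPolyVerifierFor V p T) (hO : OracleOK V p D O)
    (hfit : ∀ ℓ, FitsLv p D ℓ (OracleCompose.body (esOf V p ℓ))) (x : List Bool) :
    bitW V p D O (lpad (2 * D) x) = [true] ↔ ones (2 ^ x.length + bitsToNat x) ∈ T := by
  have h := readBit_iff_of_tableOK hver (tableOK_esOf (V := V) (p := p) x.length) [] [] (bitsToNat_lt x)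
  rw [readBit, fstF_boolPair] at h
  rw [← h, bitW, Function.comp_apply, Function.comp_apply, fanoutFn_apply, idxOnesFn_lpad hD, tabW_lpad hD hO hfit]

variable (V p D O) in
/-- **The language decided by the algorithm**: `{x | bitW (lpad (2D) x) = [1]}`. [folklore] -/
def SearchLang : Language Bool := lpad (2 * D) ⁻¹' ({w | bitW V p D O w = (fun _ => [true]) w} : Language Bool)

/-- **The algorithm runs in time `2^{O(n)}`**: `SearchLang ∈ E` when the oracle is in `P`. [cite: ChenEtAl2022, §6 (Proof of Thm. 1.9, Claim 1: "the total time … is at most 2^{O(m)}")] -/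
theorem SearchLang_mem_E (hO : O ∈ Classes.P) : SearchLang V p D O ∈ E :=
  preimage_mem_E (lpad_mem_FE _) (setOf_apply_eq_apply_mem_P (bitW_mem_FP hO) (const_mem_FP _))

/-- **Claim 1, as used**: if the oracle `O` is in `P` and answers the `Hq`-questions on certified tables
(as `B` does), then the language `L'` tally-coded by `T` (`x ∈ L' ↔ 1^{⟦x⟧ + 2^{|x|}} ∈ T`) is in `E`.
[cite: ChenEtAl2022, §6 (Proof of Thm. 1.9, Claim 1)] -/
theorem mem_E_of_oracle {T L' : Language Bool} (hD : 0 < D) (hver : IsPolyVerifierFor V p T) (hO : OracleOK V p D O)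
    (hOP : O ∈ Classes.P) (hfit : ∀ ℓ, FitsLv p D ℓ (OracleCompose.body (esOf V p ℓ)))
    (hL' : ∀ x, x ∈ L' ↔ ones (bitsToNat x + 2 ^ x.length) ∈ T) : L' ∈ E := by
  have heq : L' = SearchLang V p D O := by
    ext x
    rw [hL', SearchLang, memL_preimage, Nat.add_comm, ← bitW_lpad_iff hD hver hO hfit x]
    exact Iff.rfl
  rw [heq]
  exact SearchLang_mem_E hOP

end Outer


section FitArith

variable {V : Language Bool} {p : Polynomial ℕ} {D : ℕ}

/-! #### G7. The format constant: a `D` for which every query of every level fits -/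

/-- `8a + 26 ≤ 2^{a+5}`. [folklore] -/
theorem eight_mul_add_le_two_pow (a : ℕ) : 8 * a + 26 ≤ 2 ^ (a + 5) := by
  have h : a + 1 ≤ 2 ^ a := Nat.lt_two_pow_self
  rw [pow_add]
  norm_num
  nlinarith

/-- **Choice of the format constant.** For `p ≤ a n^k + a` and `D = 2k + a + 7`, the content of every oracle
call of level `ℓ` — twice a table of `2^ℓ` entries of size `≤ p(2^{ℓ+1}) + 4`, twice a query of size
`≤ 2·2^{ℓ+2} + p(2^{ℓ+2}) + 4`, plus `4` — is at most `canon D ℓ = 2^{D(ℓ+1)}`. [folklore] -/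
theorem exists_canon_fits (p : Polynomial ℕ) : ∃ D : ℕ, 0 < D ∧ ∀ ℓ : ℕ,
    2 * (2 ^ ℓ * (2 * p.eval (2 ^ (ℓ + 1)) + 10)) + 2 * (2 * 2 ^ (ℓ + 2) + p.eval (2 ^ (ℓ + 2)) + 4) + 4 ≤
      canon D ℓ := by
  obtain ⟨a, k, hak⟩ := exists_eval_le_mul_pow_add p
  refine ⟨2 * k + a + 7, by omega, fun ℓ => ?_⟩
  set E := 2 ^ ((ℓ + 2) * k) with hE
  have hE1 : 1 ≤ E := Nat.one_le_two_pow
  have h1 : p.eval (2 ^ (ℓ + 1)) ≤ a * E + a := (hak _).trans (by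
    rw [hE, ← pow_mul]
    exact Nat.add_le_add_right (Nat.mul_le_mul_left a (Nat.pow_le_pow_right two_pos (by nlinarith))) a)
  have h2 : p.eval (2 ^ (ℓ + 2)) ≤ a * E + a := (hak _).trans (by rw [hE, ← pow_mul])
  have h3 : (2 : ℕ) ≤ 2 ^ (ℓ + 1) := by
    have := Nat.one_le_two_pow (n := ℓ); rw [pow_succ]; omega
  -- the content is at most `2^{ℓ+1} · E · (8a + 26)`
  have h4 : 2 * (2 ^ ℓ * (2 * p.eval (2 ^ (ℓ + 1)) + 10)) + 2 * (2 * 2 ^ (ℓ + 2) + p.eval (2 ^ (ℓ + 2)) + 4) + 4 ≤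
      2 ^ (ℓ + 1) * E * (8 * a + 26) := by
    have e1 : 2 * (2 ^ ℓ * (2 * p.eval (2 ^ (ℓ + 1)) + 10)) = 2 ^ (ℓ + 1) * (2 * p.eval (2 ^ (ℓ + 1)) + 10) := by
      rw [pow_succ]; ring
    have e2 : (2 : ℕ) * 2 ^ (ℓ + 2) = 2 ^ (ℓ + 1) * 4 := by rw [pow_succ, pow_succ]; ring
    rw [e1, e2]
    nlinarith [Nat.mul_le_mul h3 hE1, Nat.mul_le_mul_left (2 ^ (ℓ + 1)) h1, h2, Nat.mul_le_mul_left (2 ^ (ℓ + 1)) hE1,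
      Nat.mul_le_mul_left a hE1]
  refine h4.trans ?_
  -- and `2^{ℓ+1} · E · (8a+26) ≤ 2^{ℓ+1} · E · 2^{a+5} = 2^{ℓ+1+(ℓ+2)k+a+5} ≤ 2^{D(ℓ+1)}`
  calc 2 ^ (ℓ + 1) * E * (8 * a + 26) ≤ 2 ^ (ℓ + 1) * E * 2 ^ (a + 5) :=
        Nat.mul_le_mul_left _ (eight_mul_add_le_two_pow a)
    _ = 2 ^ (ℓ + 1 + (ℓ + 2) * k + (a + 5)) := by rw [hE, ← pow_add, ← pow_add]
    _ ≤ canon (2 * k + a + 7) ℓ := Nat.pow_le_pow_right two_pos (by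
        rw [show (2 * k + a + 7) * (ℓ + 1) = 2 * k * (ℓ + 1) + (a + 7) * (ℓ + 1) from by ring]; nlinarith)

/-- **The size hypothesis of every level holds for such a `D`.** [folklore] -/
theorem fitsLv_of_canon_fits (h : ∀ ℓ : ℕ,
      2 * (2 ^ ℓ * (2 * p.eval (2 ^ (ℓ + 1)) + 10)) + 2 * (2 * 2 ^ (ℓ + 2) + p.eval (2 ^ (ℓ + 2)) + 4) + 4 ≤ canon D ℓ)
    (ℓ : ℕ) : FitsLv p D ℓ (OracleCompose.body (esOf V p ℓ)) := fun q hq => by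
  have ht := length_body_esOf_le (V := V) (p := p) ℓ
  have := h ℓ
  unfold Fits
  omega

end FitArith

end NoRefuter

end Literature.Computability.MetaComplexity
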